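import Literature.AlgebraicGeometry.Resolution.ResidueFieldRepresentatives
import Literature.AlgebraicGeometry.Resolution.NormalDegreePDefectlessArtinSchreier
import Literature.AlgebraicGeometry.Resolution.HenselsLemmaProofs
import Literature.AlgebraicGeometry.Resolution.HenselizationCompositum
import Literature.AlgebraicGeometry.Resolution.ResidueTranscendentalExtensions
import Literature.AlgebraicGeometry.Resolution.HenselizedFunctionFieldsReduction
import Mathlib.FieldTheory.RatFunc.AsPolynomial
import Mathlib.FieldTheory.PrimitiveElement
import HarnessLib

/-!
# The residue field of a henselized inertially generated function field embeds into it (Kuhlmann 2010, Lemma 4.10)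

Topic: `Literature/AlgebraicGeometry/Resolution` (valued function fields). Second step of the
proof of F.-V. Kuhlmann, *Elimination of ramification I: The generalized stability theorem*,
Trans. AMS 362 (2010) 5697–5727 = arXiv:1003.5678, **Lemma 4.10** (p. 14 of the arXiv version;
the named fact `Kuhlmann2010Lemma410` of `FrobeniusClosedBases.lean` is its second assertion):

> **Lemma 4.10.** In the case of `char K = p` there exists an embedding of the residue field
> `F̄` in `F` respecting the residue map such that `K̄ = K ∩ F̄`, that `K` is linearly disjoint
> from `F̄` over `K̄` and that `F = (K.F̄)^h`. […]

with its printed proof (p. 14): "This embedding [of `K̄` in `K`, `ResidueFieldRepresentatives.lean`]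
can be extended to an embedding of `F̄` in `F` as follows. By (2.7), we can view the polynomial
`f̄(x,Y)` as a polynomial over `K(x) ⊂ F`; … it follows by Hensel's Lemma that this polynomial
in `Y` has exactly one zero `y' ∈ F` with `ȳ' = ȳ`. … The residue map induces on `K̄` the
identity and an isomorphism `K̄(x) → K̄(x̄)` since both `x` and `x̄` are transcendental over `K̄`.
It … induces an isomorphism `K̄(x,y') → K̄(x̄,ȳ) = F̄`. By this isomorphism we identify `x = x̄`,
`y' = ȳ` such that `F̄ ⊂ F`, `F = (K.F̄)^h`."

This file PROVES the first assertion of Lemma 4.10 in the ambient rendering of the tree — one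
algebraically closed valued field `(Ω, V)` of characteristic `p`, `K ≤ Ω` an algebraically closed
subfield, `F` in the class `IsHenselizedInertiallyGeneratedRT V K` (§2.5: a finite unramified
extension of the henselization `K(x)^h` of `K(x)`, `x` residue-transcendental, rank one): there is
a ring homomorphism `ι : F̄ → Ω` with values in `F ∩ V` which is a section of the residue map,
maps `K̄` into `K`, and satisfies `F ≤ (K.ι(F̄))^h` (hence `F = (K.ι(F̄))^h`, as `K.ι(F̄) ≤ F` and
`F` is henselian). The transcendental part `K̄(x̄) → K(x)` is `RatFunc.liftRingHom` through
`RatFunc.algEquivOfTranscendental`; the algebraic part is Hensel's Lemma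
(`Kuhlmann2010HenselsLemma_holds`) applied to the minimal polynomial of a primitive element `ȳ`
of the finite separable extension `F̄|K̄(x̄)` (`IsUnramifiedOver`), through
`IntermediateField.algHomAdjoinIntegralEquiv`; `F ≤ (K.ι(F̄))^h` is the degree count of the source
("`K(x)^h(y') = K(x)^h(y) = F`"): `K(x)^h ≤ (K.ι(F̄))^h ≤ F` has residue field `F̄`, so by the
fundamental inequality its degree over `K(x)^h` is at least `[F̄ : K̄(x̄)] = [F : K(x)^h]`.

## Content (everything PROVED)

* `residComp`, `resid_eval₂`, `eval₂_mem_subring`, `resid_div` — residues of polynomial values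
  and quotients.
* `reprHom` — the field of representatives of `ResidueFieldRepresentatives.lean` as a ring
  homomorphism `K̄ →+* Ω` (a section of the residue map with values in `K`).
* `exists_ratFunc_section` — the section on `K̄(x̄)`, `x̄ ↦ x` ("an isomorphism `K̄(x) → K̄(x̄)`").
* `exists_adjoin_section_of_isSeparable` — one Hensel step: a section on `L` with values in a
  field `F` whose valuation ring satisfies Hensel's Lemma extends to `L(ȳ)` for `ȳ ∈ F̄`
  separable over `L` ("by Hensel's Lemma … exactly one zero `y' ∈ F` with `ȳ' = ȳ`").
* `exists_residueField_section` — **Lemma 4.10, first assertion**, for the fields of the class.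

## Sources

* F.-V. Kuhlmann, Trans. AMS 362 (2010) = arXiv:1003.5678, §2.5 ((2.7), p. 9), §4.2,
  Lemma 4.10 and its proof (p. 14); §1 (1) (fundamental inequality).
-/

noncomputable section

open IsLocalRing Polynomial

namespace Literature.AlgebraicGeometry.Resolution

universe u

variable {Ω : Type u} [Field Ω] (V : ValuationSubring Ω)

/-! ### Residues of polynomial values and quotients -/

section Resid

/-- The residue map composed with a ring homomorphism `j : T → Ω` taking values in `V`. [folklore] -/
def residComp {T : Type*} [CommRing T] (j : T →+* Ω) (hj : ∀ t, j t ∈ V) : T →+* ResidueField V :=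
  (residue V).comp (j.codRestrict V hj)

/-- `residComp` on an element. [folklore] -/
@[simp]
theorem residComp_apply {T : Type*} [CommRing T] (j : T →+* Ω) (hj : ∀ t, j t ∈ V) (t : T) :
    residComp V j hj t = resid V (j t) :=
  (resid_of_mem V (hj t)).symm

/-- **`P(c)‾ = P̄(c̄)`** for a polynomial `P` over `T`, evaluated through `j : T → Ω` with values
in `V`, at `c ∈ V`: the value lies in `V` and its residue is the value at `c̄` of the polynomial
with residue coefficients. [folklore] -/
theorem resid_eval₂ {T : Type*} [CommRing T] (j : T →+* Ω) (hj : ∀ t, j t ∈ V) {c : Ω} (hc : c ∈ V)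
    (P : Polynomial T) :
    P.eval₂ j c ∈ V ∧ resid V (P.eval₂ j c) = P.eval₂ (residComp V j hj) (resid V c) := by
  have h1 : P.eval₂ j c = ((P.eval₂ (j.codRestrict V hj) ⟨c, hc⟩ : V) : Ω) := by
    rw [show ((P.eval₂ (j.codRestrict V hj) ⟨c, hc⟩ : V) : Ω) =
      V.subtype (P.eval₂ (j.codRestrict V hj) ⟨c, hc⟩) from rfl, hom_eval₂]
    rfl
  refine ⟨by rw [h1]; exact Subtype.mem _, ?_⟩
  rw [h1, resid_coe, hom_eval₂, resid_of_mem V hc]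
  rfl

omit V in
/-- `P(c) ∈ S` for a subring `S` containing the coefficients (through `j`) and `c`. [folklore] -/
theorem eval₂_mem_subring {T : Type*} [CommRing T] (j : T →+* Ω) {S : Subring Ω} (hj : ∀ t, j t ∈ S)
    {c : Ω} (hc : c ∈ S) (P : Polynomial T) : P.eval₂ j c ∈ S := by
  rw [eval₂_eq_sum_range]
  exact S.sum_mem fun i _ => S.mul_mem (hj _) (S.pow_mem hc i)

/-- **Residue of a quotient by a unit**: for `a, b ∈ V` with `vb = 1`, `a/b ∈ V` and
`(a/b)‾ = ā/b̄`. [folklore] -/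
theorem resid_div {a b : Ω} (ha : a ∈ V) (hb : b ∈ V) (hvb : V.valuation b = 1) :
    a / b ∈ V ∧ resid V (a / b) = resid V a / resid V b := by
  have hb0 : b ≠ 0 := by
    rintro rfl
    rw [map_zero] at hvb
    exact zero_ne_one hvb
  have hmem : a / b ∈ V := by
    rw [← V.valuation_le_one_iff, map_div₀, hvb, div_one]
    exact (V.valuation_le_one_iff a).mpr ha
  refine ⟨hmem, ?_⟩
  have hrb : resid V b ≠ 0 := (resid_ne_zero_iff V hb).mpr hvb
  rw [eq_div_iff hrb, ← resid_mul V hmem hb, div_mul_cancel₀ a hb0]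

end Resid

/-! ### The field of representatives as a ring homomorphism `K̄ → K` -/

section ReprHom

variable {K k : Subfield Ω}

/-- The residue map is injective on a subfield `k ⊆ V`. [folklore] -/
theorem eq_of_resid_eq (hkV : ∀ a ∈ k, a ∈ V) {a b : Ω} (ha : a ∈ k) (hb : b ∈ k)
    (h : resid V a = resid V b) : a = b := by
  by_contra hne
  have h1 : V.valuation (a - b) = 1 :=
    valuation_eq_one_of_subset V hkV (k.sub_mem ha hb) (sub_ne_zero.mpr hne)
  have h2 : resid V (a - b) = 0 := by
    rw [resid_sub V (hkV a ha) (hkV b hb), h, sub_self]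
  rw [resid_eq_zero_iff V (hkV _ (k.sub_mem ha hb)), h1] at h2
  exact lt_irrefl _ h2

/-- **The embedding `K̄ → K`** given by a field of representatives `k ≤ K`, `k ⊆ V`, whose
residues exhaust `K̄` (Kuhlmann 2010, proof of Lemma 4.10: "We identify this field with `K̄`, so
that we can write `K̄ ⊂ K` with `ā = a` for all `a ∈ K̄`"): each residue is sent to its unique
representative in `k`. [cite: Kuhlmann2010, Lemma 4.10 (proof, p. 14)] -/
def reprHom (hkV : ∀ a ∈ k, a ∈ V) (hsurj : ∀ r ∈ residueSubfield K V, ∃ a ∈ k, resid V a = r) :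
    residueSubfield K V →+* Ω where
  toFun r := Classical.choose (hsurj r r.2)
  map_one' := by
    obtain ⟨hmem, hres⟩ := Classical.choose_spec (hsurj (1 : residueSubfield K V) (1 : residueSubfield K V).2)
    exact eq_of_resid_eq V hkV hmem k.one_mem (by rw [hres, resid_one]; rfl)
  map_mul' r s := by
    obtain ⟨hmem, hres⟩ := Classical.choose_spec (hsurj (r * s : residueSubfield K V) (r * s).2)
    obtain ⟨hr, hrr⟩ := Classical.choose_spec (hsurj r r.2)
    obtain ⟨hs, hss⟩ := Classical.choose_spec (hsurj s s.2)
    refine eq_of_resid_eq V hkV hmem (k.mul_mem hr hs) ?_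
    rw [hres, resid_mul V (hkV _ hr) (hkV _ hs), hrr, hss]
    rfl
  map_zero' := by
    obtain ⟨hmem, hres⟩ := Classical.choose_spec (hsurj (0 : residueSubfield K V) (0 : residueSubfield K V).2)
    exact eq_of_resid_eq V hkV hmem k.zero_mem (by rw [hres, resid_zero]; rfl)
  map_add' r s := by
    obtain ⟨hmem, hres⟩ := Classical.choose_spec (hsurj (r + s : residueSubfield K V) (r + s).2)
    obtain ⟨hr, hrr⟩ := Classical.choose_spec (hsurj r r.2)
    obtain ⟨hs, hss⟩ := Classical.choose_spec (hsurj s s.2)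
    refine eq_of_resid_eq V hkV hmem (k.add_mem hr hs) ?_
    rw [hres, resid_add V (hkV _ hr) (hkV _ hs), hrr, hss]
    rfl

/-- The representative lies in `k`. [folklore] -/
theorem reprHom_mem (hkV : ∀ a ∈ k, a ∈ V) (hsurj : ∀ r ∈ residueSubfield K V, ∃ a ∈ k, resid V a = r)
    (r : residueSubfield K V) : reprHom V hkV hsurj r ∈ k :=
  (Classical.choose_spec (hsurj r r.2)).1

/-- The representative has the given residue. [folklore] -/
theorem resid_reprHom (hkV : ∀ a ∈ k, a ∈ V) (hsurj : ∀ r ∈ residueSubfield K V, ∃ a ∈ k, resid V a = r)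
    (r : residueSubfield K V) : resid V (reprHom V hkV hsurj r) = r :=
  (Classical.choose_spec (hsurj r r.2)).2

end ReprHom

/-! ### The section on `K̄(x̄)` -/

section RatFuncSection

/-- **The residue map induces an isomorphism `K̄(x) → K̄(x̄)`** (Kuhlmann 2010, proof of
Lemma 4.10, p. 14: "since both `x` and `x̄` are transcendental over `K̄`"): a section
`ι₀ : K̄ → Ω` of the residue map with values in `V` extends, for `x` residue-transcendental over
`K`, to a section `ι₁` of the residue map on `K̄(x̄) ⊆ Ωv` with `ι₁(x̄) = x`, taking values in
`V` and in every subfield containing `ι₀(K̄)` and `x` (a polynomial `P(x)`, `P ≠ 0` with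
coefficients in `ι₀(K̄)`, has residue `P̄(x̄) ≠ 0`, so `K̄[X] → Ω` is injective with unit values
and extends to the rational function field). PROVED. [cite: Kuhlmann2010, Lemma 4.10 (proof, p. 14)] -/
theorem exists_ratFunc_section {K : Subfield Ω} (ι₀ : residueSubfield K V →+* Ω)
    (h₀V : ∀ c, ι₀ c ∈ V) (h₀res : ∀ c, resid V (ι₀ c) = c) {x : Ω}
    (hx : IsResidueTranscendental V K x) :
    ∃ (htr : Transcendental (residueSubfield K V) (resid V x))
      (ι₁ : IntermediateField.adjoin (residueSubfield K V) ({resid V x} : Set (ResidueField V)) →+* Ω),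
      (∀ T : Subfield Ω, (∀ c, ι₀ c ∈ T) → x ∈ T → ∀ z, ι₁ z ∈ T) ∧ (∀ z, ι₁ z ∈ V) ∧
      (∀ z, resid V (ι₁ z) = z) ∧
      (∀ c, ι₁ (algebraMap (residueSubfield K V) _ c) = ι₀ c) ∧
      ι₁ ((RatFunc.algEquivOfTranscendental (resid V x) htr) RatFunc.X) = x := by
  classical
  obtain ⟨hxV, htr⟩ := hx
  rw [← residueSubfield_subfield_eq_resField V K, ← resid_of_mem V hxV] at htr
  refine ⟨htr, ?_⟩
  -- `φ : K̄[X] → Ω`, `P ↦ P^{ι₀}(x)`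
  set φ : Polynomial (residueSubfield K V) →+* Ω := eval₂RingHom ι₀ x with hφ
  have hφapply : ∀ P, φ P = P.eval₂ ι₀ x := fun P => rfl
  have hcomp : residComp V ι₀ h₀V = algebraMap (residueSubfield K V) (ResidueField V) := by
    refine RingHom.ext fun c => ?_
    rw [residComp_apply, h₀res]
    rfl
  have hφV : ∀ P, φ P ∈ V := fun P => (resid_eval₂ V ι₀ h₀V hxV P).1
  have hφres : ∀ P, resid V (φ P) = aeval (resid V x) P := by
    intro P
    rw [hφapply, (resid_eval₂ V ι₀ h₀V hxV P).2, hcomp, aeval_def]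
  have hφ1 : ∀ P, P ≠ 0 → V.valuation (φ P) = 1 := by
    intro P hP0
    rw [← resid_ne_zero_iff V (hφV P), hφres]
    exact fun h0 => htr ⟨P, hP0, h0⟩
  have hφne : ∀ P, P ≠ 0 → φ P ≠ 0 := by
    intro P hP0 h0
    have h1 := hφ1 P hP0
    rw [h0, map_zero] at h1
    exact zero_ne_one h1
  have hφT : ∀ T : Subfield Ω, (∀ c, ι₀ c ∈ T) → x ∈ T → ∀ P, φ P ∈ T := fun T hT hxT P =>
    eval₂_mem_subring ι₀ (S := T.toSubring) hT hxT P
  -- extension to the rational function field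
  have hφ0 : nonZeroDivisors (Polynomial (residueSubfield K V)) ≤ (nonZeroDivisors Ω).comap φ :=
    fun q hq => mem_nonZeroDivisors_of_ne_zero (hφne q (nonZeroDivisors.ne_zero hq))
  set ψ : RatFunc (residueSubfield K V) →+* Ω := RatFunc.liftRingHom φ hφ0 with hψ
  have hψapply : ∀ u : RatFunc (residueSubfield K V), ψ u = φ u.num / φ u.denom := fun u =>
    RatFunc.liftRingHom_apply φ hφ0 u
  have hψalg : ∀ P : Polynomial (residueSubfield K V),
      ψ (algebraMap (Polynomial (residueSubfield K V)) (RatFunc (residueSubfield K V)) P) = φ P := by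
    intro P
    rw [hψapply, RatFunc.num_algebraMap, RatFunc.denom_algebraMap, map_one, div_one]
  have hψV : ∀ u, ψ u ∈ V ∧ resid V (ψ u) = aeval (resid V x) u.num / aeval (resid V x) u.denom := by
    intro u
    obtain ⟨hmem, hres⟩ := resid_div V (hφV u.num) (hφV u.denom) (hφ1 _ (RatFunc.denom_ne_zero u))
    rw [hψapply]
    exact ⟨hmem, by rw [hres, hφres, hφres]⟩
  -- through `K̄(x̄) ≅ RatFunc K̄`
  set e := RatFunc.algEquivOfTranscendental (resid V x) htr with he
  set ι₁ : IntermediateField.adjoin (residueSubfield K V) ({resid V x} : Set (ResidueField V)) →+* Ω :=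
    ψ.comp e.symm.toAlgHom.toRingHom with hι₁
  have hι₁apply : ∀ z, ι₁ z = ψ (e.symm z) := fun z => rfl
  refine ⟨ι₁, fun T hT hxT z => ?_, fun z => (hψV _).1, fun z => ?_, fun c => ?_, ?_⟩
  · rw [hι₁apply, hψapply]
    exact T.div_mem (hφT T hT hxT _) (hφT T hT hxT _)
  · rw [hι₁apply, (hψV _).2, ← RatFunc.algEquivOfTranscendental_apply (resid V x) htr (e.symm z),
      ← he, e.apply_symm_apply]
  · rw [hι₁apply, show e.symm (algebraMap (residueSubfield K V) _ c) =
        algebraMap (residueSubfield K V) (RatFunc (residueSubfield K V)) c from e.symm.commutes c,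
      IsScalarTower.algebraMap_apply (residueSubfield K V) (Polynomial (residueSubfield K V))
        (RatFunc (residueSubfield K V)),
      hψalg, Polynomial.algebraMap_eq, hφapply, eval₂_C]
  · rw [hι₁apply, e.symm_apply_apply, ← RatFunc.algebraMap_X, hψalg, hφapply, eval₂_X]

end RatFuncSection

/-! ### One Hensel step -/

section HenselStep

/-- **Extending a section of the residue map over a separable residue** (Kuhlmann 2010, proof
of Lemma 4.10, p. 14: "from (2.8) it follows by Hensel's Lemma that this polynomial in `Y` has
exactly one zero `y' ∈ F` with `ȳ' = ȳ` … it induces an isomorphism `K̄(x,y') → K̄(x̄,ȳ)`"):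
let `F ≤ Ω` be a subfield whose valuation ring `V ∩ F` satisfies Hensel's Lemma, `L` a field
over `Ωv` and `ι₁ : L → Ω` a ring homomorphism with values in `F ∩ V` which is a section of the
residue map; then for every `ȳ ∈ F̄` separable over `L`, `ι₁` extends to a section
`ι : L(ȳ) → Ω` of the residue map with values in `F ∩ V` — the root `y ∈ F` of the lifted
minimal polynomial `g = ḡ^{ι₁}` with `ȳ = ȳ` given by Hensel's Lemma defines
`L(ȳ) ≅ L[Y]/(ḡ) → Ω`, `Y ↦ y` (`IntermediateField.algHomAdjoinIntegralEquiv`), and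
`P^{ι₁}(y)‾ = P(ȳ)`. PROVED. [cite: Kuhlmann2010, Lemma 4.10 (proof, p. 14)] -/
theorem exists_adjoin_section_of_isSeparable (L : Type u) [Field L] [Algebra L (ResidueField V)]
    {F : Subfield Ω} (hF : HenselianLocalRing (V.comap (algebraMap F Ω))) (ι₁ : L →+* Ω)
    (h₁F : ∀ z, ι₁ z ∈ F) (h₁V : ∀ z, ι₁ z ∈ V)
    (h₁res : ∀ z, resid V (ι₁ z) = algebraMap L (ResidueField V) z)
    {ybar : ResidueField V} (hyF : ybar ∈ residueSubfield F V) (hsep : IsSeparable L ybar) :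
    ∃ ι : IntermediateField.adjoin L ({ybar} : Set (ResidueField V)) →+* Ω,
      (∀ w, ι w ∈ F) ∧ (∀ w, ι w ∈ V) ∧ (∀ w, resid V (ι w) = w) ∧
      ∀ z : L, ι (algebraMap L _ z) = ι₁ z := by
  classical
  haveI := hF
  set OF : ValuationSubring F := V.comap (algebraMap F Ω) with hOF
  -- `ι₁` with values in `V ∩ F`
  set ι₁F : L →+* F := ι₁.codRestrict F h₁F with hι₁F
  set ι₁O : L →+* OF := ι₁F.codRestrict OF fun z => show algebraMap F Ω (ι₁F z) ∈ V from h₁V z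
    with hι₁O
  have hθ : (residueHom V F).comp ι₁O = algebraMap L (ResidueField V) := by
    refine RingHom.ext fun z => ?_
    rw [RingHom.comp_apply, residueHom_apply, ← h₁res z, resid_of_mem V (h₁V z)]
    rfl
  -- the minimal polynomial and its lift
  have hint : IsIntegral L ybar := hsep.isIntegral
  set gbar : Polynomial L := minpoly L ybar with hgbar
  set gO : Polynomial OF := gbar.map ι₁O with hgO
  have hmonO : gO.Monic := (minpoly.monic hint).map _
  -- a first approximation `a₀` of residue `ȳ`
  obtain ⟨c, hcV, hc⟩ := (mem_residueSubfield_iff F V ybar).mp hyF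
  set a₀ : OF := ⟨c, hcV⟩ with ha₀
  have hθa₀ : residueHom V F a₀ = ybar := hc
  have heval : ∀ q : Polynomial L,
      residueHom V F ((q.map ι₁O).eval a₀) = aeval ybar q := fun q => by
    rw [eval_map, hom_eval₂, hθ, hθa₀, aeval_def]
  have h1 : gO.eval a₀ ∈ maximalIdeal OF := by
    rw [← residueHom_eq_zero_iff, hgO, heval, hgbar, minpoly.aeval]
  have h2 : IsUnit (gO.derivative.eval a₀) := by
    by_contra hnu
    have hmem : gO.derivative.eval a₀ ∈ maximalIdeal OF := (IsLocalRing.mem_maximalIdeal _).mpr hnu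
    rw [← residueHom_eq_zero_iff, hgO, derivative_map, heval] at hmem
    exact (Polynomial.Separable.aeval_derivative_ne_zero hsep (minpoly.aeval L ybar)) hmem
  -- Hensel's Lemma
  obtain ⟨y₀, hy₀, hy₀a⟩ := HenselianLocalRing.is_henselian gO hmonO a₀ h1 h2
  set y : Ω := ((y₀ : F) : Ω) with hy
  have hyF' : y ∈ F := (y₀ : F).2
  have hyV : y ∈ V := y₀.2
  have hres_y : resid V y = ybar := by
    have h4 : residueHom V F (y₀ - a₀) = 0 := (residueHom_eq_zero_iff V F _).mpr hy₀a
    rw [map_sub, sub_eq_zero, hθa₀, residueHom_apply] at h4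
    rw [hy, resid_of_mem V hyV]
    exact h4
  have hroot : gbar.eval₂ ι₁ y = 0 := by
    have h3 : ((algebraMap F Ω).comp (algebraMap OF F)) (gO.eval y₀) = 0 := by
      rw [hy₀.eq_zero, map_zero]
    rw [hgO, eval_map, hom_eval₂] at h3
    exact h3
  -- `Ω` as an `L`-algebra through `ι₁`; `y` is a root of the minimal polynomial
  letI : Algebra L Ω := ι₁.toAlgebra
  have halg : (algebraMap L Ω : L →+* Ω) = ι₁ := rfl
  have hy_aroots : y ∈ (minpoly L ybar).aroots Ω := by
    rw [mem_aroots, aeval_def, halg]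
    exact ⟨minpoly.ne_zero hint, hroot⟩
  set ψ : IntermediateField.adjoin L ({ybar} : Set (ResidueField V)) →ₐ[L] Ω :=
    (IntermediateField.algHomAdjoinIntegralEquiv L hint).symm ⟨y, hy_aroots⟩ with hψ
  have hψgen : ψ (IntermediateField.AdjoinSimple.gen L ybar) = y :=
    IntermediateField.algHomAdjoinIntegralEquiv_symm_apply_gen L hint ⟨y, hy_aroots⟩
  -- every element of `L(ȳ)` is a polynomial in `ȳ`
  have hrepr : ∀ w : IntermediateField.adjoin L ({ybar} : Set (ResidueField V)),
      ∃ P : Polynomial L, w = aeval (IntermediateField.AdjoinSimple.gen L ybar) P ∧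
        (w : ResidueField V) = aeval ybar P := by
    intro w
    obtain ⟨P, -, hP⟩ := (IntermediateField.adjoin.powerBasis hint).exists_eq_aeval w
    rw [IntermediateField.adjoin.powerBasis_gen] at hP
    refine ⟨P, hP, ?_⟩
    rw [hP, ← IntermediateField.AdjoinSimple.algebraMap_gen L ybar, aeval_algebraMap_apply]
    rfl
  refine ⟨ψ.toRingHom, fun w => ?_, fun w => ?_, fun w => ?_, fun z => ?_⟩
  · obtain ⟨P, hP, -⟩ := hrepr w
    rw [AlgHom.toRingHom_eq_coe, RingHom.coe_coe, hP, ← aeval_algHom_apply, hψgen, aeval_def, halg]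
    exact eval₂_mem_subring ι₁ (S := F.toSubring) h₁F hyF' P
  · obtain ⟨P, hP, -⟩ := hrepr w
    rw [AlgHom.toRingHom_eq_coe, RingHom.coe_coe, hP, ← aeval_algHom_apply, hψgen, aeval_def, halg]
    exact (resid_eval₂ V ι₁ h₁V hyV P).1
  · obtain ⟨P, hP, hPw⟩ := hrepr w
    rw [AlgHom.toRingHom_eq_coe, RingHom.coe_coe, hPw]
    rw [hP, ← aeval_algHom_apply, hψgen, aeval_def, halg, (resid_eval₂ V ι₁ h₁V hyV P).2, hres_y]
    have hcomp : residComp V ι₁ h₁V = algebraMap L (ResidueField V) := by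
      refine RingHom.ext fun z => ?_
      rw [residComp_apply, h₁res]
    rw [hcomp, aeval_def]
  · rw [AlgHom.toRingHom_eq_coe, RingHom.coe_coe, AlgHom.commutes, halg]

end HenselStep

/-! ### From `L = H̄` to `F̄`: the section on the residue field of an unramified extension -/

section Unramified

/-- **`F̄|H̄` is finite separable of degree `[F : H]` for `F|H` finite unramified**, as an
extension of intermediate fields of `Ωv`: for an intermediate field `L` (over any `Kb`) with
underlying subfield `H̄`, the intermediate field `E` over `L` with underlying set `F̄` is finite of
degree `[F : H]` and separable over `L` (`IsUnramifiedOver`: `[F : H] = [F̄ : H̄]`, `F̄|H̄`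
separable). [folklore] -/
theorem finrank_residue_extension {H F : Subfield Ω} (hunr : IsUnramifiedOver V H F)
    (Kb : Subfield (ResidueField V)) (L : IntermediateField Kb (ResidueField V))
    (hL : L.toSubfield = residueSubfield H V)
    (hKbF : ∀ c : Kb, algebraMap Kb (ResidueField V) c ∈ residueSubfield F V)
    (hLF : L ≤ (residueSubfield F V).toIntermediateField hKbF) :
    Module.finrank L (IntermediateField.extendScalars hLF) = Subfield.relfinrank H F ∧
      FiniteDimensional L (IntermediateField.extendScalars hLF) ∧
      Algebra.IsSeparable L (IntermediateField.extendScalars hLF) := by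
  obtain ⟨hHF, hposHF, hdegHF, hsepHF, -⟩ := hunr
  have hLres : ∀ z, z ∈ L ↔ z ∈ residueSubfield H V := fun z => by
    rw [← IntermediateField.mem_toSubfield, hL]
  set E : IntermediateField L (ResidueField V) := IntermediateField.extendScalars hLF with hE
  have hmemE : ∀ z, z ∈ E ↔ z ∈ residueSubfield F V := fun z =>
    IntermediateField.mem_extendScalars (h := hLF)
  have hfin : Module.finrank L E = Subfield.relfinrank H F := by
    rw [hdegHF, hE, ← IntermediateField.relfinrank_eq_finrank_of_le hLF]
    change Subfield.relfinrank L.toSubfield (residueSubfield F V) = _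
    rw [hL]
  haveI : FiniteDimensional L E := Module.finite_of_finrank_pos (by rw [hfin]; exact hposHF)
  have hsepL : ∀ r ∈ residueSubfield F V, IsSeparable L r := by
    intro r hr
    let f : residueSubfield H V →+* L :=
      { toFun := fun c => ⟨c.1, (hLres _).mpr c.2⟩
        map_one' := rfl
        map_mul' := fun _ _ => rfl
        map_zero' := rfl
        map_add' := fun _ _ => rfl }
    exact isSeparable_of_ringHom_comp_eq f (RingHom.ext fun _ => rfl) (hsepHF r hr)
  haveI : Algebra.IsSeparable L E :=
    ⟨fun α => IsSeparable.of_algHom E.val (hsepL α.1 ((hmemE _).mp α.2))⟩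
  exact ⟨hfin, inferInstance, inferInstance⟩

/-- **The section extends from `H̄` to `F̄` for `F|H` finite unramified** with `V ∩ F` satisfying
Hensel's Lemma: `F̄|H̄` is finite separable (`IsUnramifiedOver`), so `F̄ = H̄(ȳ)` for a primitive
element `ȳ` (`Field.exists_primitive_element`), and one Hensel step
(`exists_adjoin_section_of_isSeparable`) extends a section `ι₁ : L → F ∩ V` given on an
intermediate field `L` with underlying subfield `H̄`. PROVED. [cite: Kuhlmann2010, Lemma 4.10 (proof, p. 14)] -/
theorem exists_section_of_isUnramifiedOver {H F : Subfield Ω} (hunr : IsUnramifiedOver V H F)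
    (hF : HenselianLocalRing (V.comap (algebraMap F Ω))) (Kb : Subfield (ResidueField V))
    (L : IntermediateField Kb (ResidueField V)) (hL : L.toSubfield = residueSubfield H V)
    (ι₁ : L →+* Ω) (h₁F : ∀ z, ι₁ z ∈ F) (h₁V : ∀ z, ι₁ z ∈ V) (h₁res : ∀ z, resid V (ι₁ z) = z) :
    ∃ ι : residueSubfield F V →+* Ω,
      (∀ z, ι z ∈ F) ∧ (∀ z, ι z ∈ V) ∧ (∀ z, resid V (ι z) = z) ∧
      ∀ (z : residueSubfield F V) (hz : (z : ResidueField V) ∈ L), ι z = ι₁ ⟨z, hz⟩ := by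
  classical
  have hHF : H ≤ F := hunr.le
  have hLres : ∀ z, z ∈ L ↔ z ∈ residueSubfield H V := fun z => by
    rw [← IntermediateField.mem_toSubfield, hL]
  -- `F̄` as an intermediate field over `L`
  have hKbF : ∀ c : Kb, algebraMap Kb (ResidueField V) c ∈ residueSubfield F V := fun c =>
    residueSubfield_subfield_mono hHF ((hLres _).mp (L.algebraMap_mem c))
  have hLF : L ≤ (residueSubfield F V).toIntermediateField hKbF := fun z hz =>
    residueSubfield_subfield_mono hHF ((hLres z).mp hz)
  set E : IntermediateField L (ResidueField V) := IntermediateField.extendScalars hLF with hE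
  have hmemE : ∀ z, z ∈ E ↔ z ∈ residueSubfield F V := fun z =>
    IntermediateField.mem_extendScalars (h := hLF)
  obtain ⟨-, hfinE, hsepE⟩ := finrank_residue_extension V hunr Kb L hL hKbF hLF
  -- a primitive element `ȳ`
  obtain ⟨α, hα⟩ := Field.exists_primitive_element L E
  have hybarF : (α : ResidueField V) ∈ residueSubfield F V := (hmemE _).mp α.2
  have hadj : IntermediateField.adjoin L ({(α : ResidueField V)} : Set (ResidueField V)) = E := by
    have h1 := IntermediateField.lift_adjoin_simple L E α
    rw [hα, IntermediateField.lift_top] at h1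
    exact h1.symm
  have hmem_adj : ∀ z, z ∈ IntermediateField.adjoin L ({(α : ResidueField V)} : Set (ResidueField V)) ↔
      z ∈ residueSubfield F V := fun z => by
    rw [hadj]
    exact hmemE z
  -- one Hensel step
  obtain ⟨ι, hιF, hιV, hιres, hιalg⟩ := exists_adjoin_section_of_isSeparable V L hF ι₁ h₁F h₁V
    (fun z => h₁res z) hybarF
    ((Algebra.IsSeparable.isSeparable L α).map E.val (algebraMap E (ResidueField V)).injective)
  -- transport to `F̄`
  let castHom : residueSubfield F V →+*
      IntermediateField.adjoin L ({(α : ResidueField V)} : Set (ResidueField V)) :=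
    { toFun := fun z => ⟨z.1, (hmem_adj z.1).mpr z.2⟩
      map_one' := rfl
      map_mul' := fun _ _ => rfl
      map_zero' := rfl
      map_add' := fun _ _ => rfl }
  refine ⟨ι.comp castHom, fun z => hιF _, fun z => hιV _, fun z => hιres _, fun z hz => ?_⟩
  change ι (castHom z) = ι₁ ⟨z, hz⟩
  have h1 : castHom z =
      algebraMap L (IntermediateField.adjoin L ({(α : ResidueField V)} : Set (ResidueField V))) ⟨z, hz⟩ :=
    Subtype.ext rfl
  rw [h1, hιalg]


end Unramified

/-! ### `F = (K.F̄)^h`: the degree count -/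

section Degree

/-- **`F ≤ L₀^h` for a subfield `K(x) ≤ L₀ ≤ F` whose residue field is all of `F̄`** (Kuhlmann
2010, proof of Lemma 4.10, (4.11)–(4.12): "`K(x)^h(y') = K(x)^h(y) = F` … `F = (K.F̄)^h`"), for
`F` finite unramified over `K(x)^h` and henselian: `K(x)^h ≤ L₀^h ≤ F`
(`henselization_mono`, `henselization_le_of_isHenselianField`), the residue field of `L₀^h` is
`F̄`, so by the fundamental inequality `[L₀^h : K(x)^h] ≥ [F̄ : K̄(x̄)] = [F : K(x)^h]`, whence
`[F : L₀^h] = 1`. PROVED. [cite: Kuhlmann2010, Lemma 4.10 (proof, p. 14)] -/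
theorem le_henselization_of_residueSubfield_le [IsAlgClosed Ω] {K F L₀ : Subfield Ω} {x : Ω}
    (hunr : IsUnramifiedOver V
      (henselization V (IntermediateField.adjoin K ({x} : Set Ω)).toSubfield) F)
    (hFh : IsHenselianField F (V.comap (algebraMap F Ω)))
    (hKL₀ : K ≤ L₀) (hxL₀ : x ∈ L₀) (hL₀F : L₀ ≤ F)
    (hres : residueSubfield F V ≤ residueSubfield L₀ V) : F ≤ henselization V L₀ := by
  set Kx : Subfield Ω := (IntermediateField.adjoin K ({x} : Set Ω)).toSubfield with hKx
  set H : Subfield Ω := henselization V Kx with hH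
  set M : Subfield Ω := henselization V L₀ with hM
  obtain ⟨hHF, hposHF, hdegHF, -, -⟩ := hunr
  have hKxL₀ : Kx ≤ L₀ := adjoin_simple_le_of_mem hKL₀ hxL₀
  have hHM : H ≤ M := henselization_mono V Kuhlmann2010HenselizationIsHenselian_holds.{u} hKxL₀
  have hMF : M ≤ F := henselization_le_of_isHenselianField V L₀ hL₀F hFh
  have hresM : residueSubfield M V = residueSubfield F V :=
    le_antisymm (residueSubfield_subfield_mono hMF)
      (hres.trans (residueSubfield_subfield_mono (le_henselization V L₀)))
  -- degrees in the tower `H ≤ M ≤ F`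
  have hmul : Subfield.relfinrank H F = Subfield.relfinrank H M * Subfield.relfinrank M F :=
    (Subfield.relfinrank_mul_relfinrank hHM hMF).symm
  have hposHM : 0 < Subfield.relfinrank H M := Nat.pos_of_ne_zero fun h0 => by
    rw [hmul, h0, zero_mul] at hposHF
    exact lt_irrefl 0 hposHF
  have hposMF : 0 < Subfield.relfinrank M F := Nat.pos_of_ne_zero fun h0 => by
    rw [hmul, h0, mul_zero] at hposHF
    exact lt_irrefl 0 hposHF
  -- fundamental inequality for `M|H`: `[M : H] ≥ [M̄ : H̄] = [F̄ : H̄] = [F : H]`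
  obtain ⟨he, -, hef⟩ := relIndex_mul_relfinrank_le_relfinrank V hHM hposHM
  rw [hresM, ← hdegHF] at hef
  have h1 : Subfield.relfinrank H F ≤ Subfield.relfinrank H M :=
    le_trans (Nat.le_mul_of_pos_left _ he) hef
  have h2 : Subfield.relfinrank M F = 1 := by
    rw [hmul] at h1
    have h3 : Subfield.relfinrank M F ≤ 1 := by
      by_contra hlt
      push Not at hlt
      exact lt_irrefl _ (lt_of_lt_of_le (lt_mul_of_one_lt_right hposHM hlt) h1)
    omega
  exact Subfield.relfinrank_eq_one_iff.mp h2

end Degree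

/-! ### Lemma 4.10, first assertion -/

section Main

/-- **`K̄(x̄)` is the residue field of `K(x)^h`** for `x` residue-transcendental over `K`
(Kuhlmann 2010, Lemma 2.5: `K(x)v = Kv(x̄)`; Lemma 2.2: the henselization is immediate,
`Kuhlmann2010HenselizationImmediate_holds`): the intermediate field `K̄(x̄) ⊆ Ωv` has the residue
field of `K(x)^h` as underlying subfield. PROVED. [cite: Kuhlmann2010, Lemma 2.5 and Lemma 2.2] -/
theorem toSubfield_adjoin_resid_eq [IsAlgClosed Ω] {K : Subfield Ω} {x : Ω}
    (hx : IsResidueTranscendental V K x) :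
    (IntermediateField.adjoin (residueSubfield K V) ({resid V x} : Set (ResidueField V))).toSubfield =
      residueSubfield (henselization V (IntermediateField.adjoin K ({x} : Set Ω)).toSubfield) V := by
  set Kx : Subfield Ω := (IntermediateField.adjoin K ({x} : Set Ω)).toSubfield with hKx
  have himm := Kuhlmann2010HenselizationImmediate_holds.{u} Ω V Kx
  have h1 : residueSubfield (henselization V Kx) V = residueSubfield Kx V := by
    apply le_antisymm
    · rw [residueSubfield_subfield_eq_resField V (henselization V Kx),
        residueSubfield_subfield_eq_resField V Kx]
      exact himm.2
    · exact residueSubfield_subfield_mono (le_henselization V Kx)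
  rw [h1, hKx, residueSubfield_adjoin_eq_of_isResidueTranscendental V hx, ← resid_of_mem V hx.mem]
  ext z
  rw [IntermediateField.mem_toSubfield, mem_adjoin_subfield_iff]

/-- **Kuhlmann 2010, Lemma 4.10 (first assertion): the residue field embeds over the residue
map, with `K̄ ↦ K` and `F = (K.F̄)^h`.** "In the case of `char K = p` there exists an embedding of
the residue field `F̄` in `F` respecting the residue map such that `K̄ = K ∩ F̄`, that `K` is
linearly disjoint from `F̄` over `K̄` and that `F = (K.F̄)^h`." Rendering: `(Ω, V)` algebraically
closed of characteristic `p`, `K ≤ Ω` an algebraically closed subfield, `F` in the class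
`IsHenselizedInertiallyGeneratedRT V K` (the fields for which `Kuhlmann2010Lemma410` is vendored);
then there is a ring homomorphism `ι : F̄ → Ω` with values in `F ∩ V`, a section of the residue
map (`(ι z)‾ = z`), mapping `K̄ = residueSubfield K V` into `K`, such that
`F ≤ (K.ι(F̄))^h` — the henselization of the subfield generated by `K` and `ι(F̄)` (which lies
in `F`; equality holds as `F` is henselian). Linear disjointness is the valuation independence
of a lifted `K̄`-basis (the next layer). PROVED: field of representatives
(`exists_subfield_of_representatives`), `K̄(x̄) → K(x)` (`exists_ratFunc_section`), Hensel
step over a primitive element (`exists_section_of_isUnramifiedOver`, with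
`Kuhlmann2010HenselsLemma_holds`), and the degree count
(`le_henselization_of_residueSubfield_le`). [cite: Kuhlmann2010, Lemma 4.10] -/
theorem exists_residueField_section [IsAlgClosed Ω] (p : ℕ) [Fact p.Prime] [CharP Ω p]
    {K F : Subfield Ω} (hK : IsAlgClosed K) (hF : IsHenselizedInertiallyGeneratedRT V K F) :
    ∃ ι : residueSubfield F V →+* Ω,
      (∀ z, ι z ∈ F) ∧ (∀ z, ι z ∈ V) ∧ (∀ z, resid V (ι z) = z) ∧
      (∀ z : residueSubfield F V, (z : ResidueField V) ∈ residueSubfield K V → ι z ∈ K) ∧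
      F ≤ henselization V (Subfield.closure ((K : Set Ω) ∪ Set.range ι)) := by
  classical
  obtain ⟨x, hx, -, hunr⟩ := id hF
  have hFh : IsHenselianField F (V.comap (algebraMap F Ω)) := hF.isHenselianField
  have hFhens : HenselianLocalRing (V.comap (algebraMap F Ω)) :=
    Kuhlmann2010HenselsLemma_holds F _ hFh
  set Kx : Subfield Ω := (IntermediateField.adjoin K ({x} : Set Ω)).toSubfield with hKx
  set H : Subfield Ω := henselization V Kx with hH
  have hHF : H ≤ F := hunr.le
  have hKxF : Kx ≤ F := (le_henselization V Kx).trans hHF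
  have hKF : K ≤ F := fun c hc =>
    hKxF ((IntermediateField.adjoin K ({x} : Set Ω)).algebraMap_mem ⟨c, hc⟩)
  have hxF : x ∈ F := hKxF (IntermediateField.mem_adjoin_simple_self K x)
  -- the field of representatives and the section on `K̄(x̄)`
  obtain ⟨k, hkK, hkV, hksurj⟩ := exists_subfield_of_representatives V p hK
  have h₀K : ∀ c, reprHom V hkV hksurj c ∈ K := fun c => hkK (reprHom_mem V hkV hksurj c)
  have h₀V : ∀ c, reprHom V hkV hksurj c ∈ V := fun c => hkV _ (reprHom_mem V hkV hksurj c)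
  have h₀res : ∀ c, resid V (reprHom V hkV hksurj c) = c := resid_reprHom V hkV hksurj
  obtain ⟨htr, ι₁, h₁T, h₁V, h₁res, h₁alg, h₁x⟩ :=
    exists_ratFunc_section V (reprHom V hkV hksurj) h₀V h₀res hx
  have h₁F : ∀ z, ι₁ z ∈ F := h₁T F (fun c => hKF (h₀K c)) hxF
  -- `K̄(x̄)` is the residue field of `H = K(x)^h`
  have hL := toSubfield_adjoin_resid_eq V hx
  obtain ⟨ι, hιF, hιV, hιres, hιL⟩ := exists_section_of_isUnramifiedOver V hunr hFhens
    (residueSubfield K V) _ hL ι₁ h₁F h₁V h₁res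
  refine ⟨ι, hιF, hιV, hιres, fun z hz => ?_, ?_⟩
  · -- `K̄ ↦ K`
    have hzL : (z : ResidueField V) ∈
        IntermediateField.adjoin (residueSubfield K V) ({resid V x} : Set (ResidueField V)) :=
      (IntermediateField.adjoin (residueSubfield K V) _).algebraMap_mem ⟨z, hz⟩
    rw [hιL z hzL, show (⟨z, hzL⟩ : IntermediateField.adjoin (residueSubfield K V)
        ({resid V x} : Set (ResidueField V))) = algebraMap (residueSubfield K V) _ ⟨z, hz⟩ from
      Subtype.ext rfl, h₁alg]
    exact h₀K _
  · -- `F ≤ (K.ι(F̄))^h`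
    set L₀ : Subfield Ω := Subfield.closure ((K : Set Ω) ∪ Set.range ι) with hL₀
    have hKL₀ : K ≤ L₀ := fun c hc => Subfield.subset_closure (Or.inl hc)
    have hιL₀ : ∀ z, ι z ∈ L₀ := fun z => Subfield.subset_closure (Or.inr ⟨z, rfl⟩)
    have hxL₀ : x ∈ L₀ := by
      have hxb : resid V x ∈ residueSubfield F V := resid_mem_residueSubfield V hxF
      have hxbL : resid V x ∈
          IntermediateField.adjoin (residueSubfield K V) ({resid V x} : Set (ResidueField V)) :=
        IntermediateField.mem_adjoin_simple_self _ _
      have h2 : ι ⟨resid V x, hxb⟩ = x := by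
        rw [hιL _ hxbL]
        have h3 : (⟨resid V x, hxbL⟩ : IntermediateField.adjoin (residueSubfield K V)
            ({resid V x} : Set (ResidueField V))) =
            RatFunc.algEquivOfTranscendental (resid V x) htr RatFunc.X :=
          Subtype.ext (by rw [RatFunc.algEquivOfTranscendental_X])
        rw [h3, h₁x]
      rw [← h2]
      exact hιL₀ _
    have hL₀F : L₀ ≤ F := Subfield.closure_le.mpr (Set.union_subset hKF (by
      rintro _ ⟨z, rfl⟩
      exact hιF z))
    have hresL₀ : residueSubfield F V ≤ residueSubfield L₀ V := fun z hz => by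
      have h2 := resid_mem_residueSubfield V (F := L₀) (hιL₀ ⟨z, hz⟩)
      rwa [hιres] at h2
    exact le_henselization_of_residueSubfield_le V hunr hFh hKL₀ hxL₀ hL₀F hresL₀

end Main

end Literature.AlgebraicGeometry.Resolution
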